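import Summits.QuantumFields.YangMills.Theorems.IR.BetaSlopeFloorRungCalculus
import Summits.QuantumFields.YangMills.Theorems.IR.BetaSlopeFloorRungMoments
import Summits.QuantumFields.YangMills.Theorems.SoloBlindOddTorusCorrelator
import Literature.MathematicalPhysics.QuantumFieldTheory.YangMillsOS

/-!
# Line `beta-slope-floor` (crux `IR`, stmt-QuantumFields-19354): the strong-coupling rung, POINTWISE form — PROVED

Route `BalabanLadder`, crux `IR` (`Summit.QuantumFields.YangMills.Theses.BalabanLadder.IR`), line
`beta-slope-floor` (skeleton `Cruxes/IR/Lines/beta_slope_floor.lean`, registered stub `stub_rung_strongCoupling`),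
lead prover `ym-ir-line-bsf-p1`.  File 4 of the series (`…RungCalculus`, `…RungHaar`, `…RungMoments`, this):

* §1 `covariance_wilsonMeasure_eq_doubled` — the DOUBLING IDENTITY on the torus:
  `Z(b)² · (⟨XY⟩_b − ⟨X⟩_b⟨Y⟩_b) = ∫ X(U) (Y(U) − Y(U')) e^{−b (S_W(U) + S_W(U'))} d(U, U')` over two independent
  product-Haar copies of the link configuration (`Z` the partition function); §2 also records
  real-analyticity of `b ↦ D_b` on `ℝ` (`analyticAt_latticeConnectedCorr`).
* §2 `le_analyticOrderAt_latticeConnectedCorr` — for a time-zero slice species `A` and `1 ≤ n ≤ S`, the connected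
  correlator `b ↦ D_b(S, A, n) = latticeConnectedCorr r.ρ b (2S+1) A A n` VANISHES AT `b = 0` TO ORDER `≥ n`
  (the doubled Haar moments of order `< n` vanish: `integral_doubledMoment_eq_zero`).
* §3 `rung_strongCoupling_pointwise` — THE RUNG, pointwise in `(S, n, A)`: for every compact `G`, lattice
  representation `r`, slice species `A`, `1 ≤ S`, `n ≤ S` there are `K` and `β_sc > 0` with
  `(n / b − K) · D_b(S, A, n) ≤ ∂_b D_b(S, A, n)` for all `0 < b ≤ β_sc`
  (order of vanishing `≥ n` + reflection positivity `D_b ≥ 0` + `exists_slope_floor_of_le_analyticOrderAt`).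

RELATION TO THE REGISTERED STUB.  `stub_rung_strongCoupling` asks for the same inequality with slope constant
`2` (here `1`) and with `β_sc` uniform in `(A, S, n)` and `K = K_A` uniform in `(S, n)`.  The VOLUME-UNIFORM form
is a statement about the `b`-derivative of the strong-coupling glueball mass uniformly in the separation
(`∂_b log D_b(n) = 4n/b + n·O(1) + O(1)`, a convergent tube re-expansion with derivative control; Osterwalder–Seiler
1978 §3 / Schor 1983–84 give the expansion, the tree's OS78 machinery gives upper bounds only) and is NOT proved
here; the lead's census records it as oversized for a rung (stub-misstated: uniformity), and this file supplies
the provable pointwise core.  The exponent `n` (not `2n` or the true `4n`) is what the pure slab-swap symmetry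
yields; `2n` needs one skew Haar translation per cut (tool landed in `…RungHaar`, not yet wired).

Honest framing: a kernel-checked strong-coupling statement on finite tori, group-blind, carrying NO weak-coupling
or mass-gap content; nothing here bears on the Yang–Mills mass gap (Clay).  R4 of the ladder closes only the
conditional finite-𝕋⁴ rung `BalabanLadder.UV`.
Refs: K. Osterwalder, E. Seiler, Ann. Phys. 110 (1978) 440, §3; B. Simon, *The Statistical Mechanics of Lattice
Gases* I (1993) §II.1; line card `Cruxes/IR/Lines/beta-slope-floor.md`.
-/

set_option autoImplicit false

noncomputable section

open MeasureTheory Filter Topology Real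
open Literature.MathematicalPhysics.QuantumFieldTheory Literature.MathematicalPhysics.QuantumLattice

namespace Summit.QuantumFields.YangMills.Cruxes.IR.BetaSlopeFloor

variable {G : Type} [Group G] [TopologicalSpace G] [IsTopologicalGroup G] [CompactSpace G]
  [MeasurableSpace G] [BorelSpace G]

/-! ## §1 Wilson expectations as tilted Haar moments; the doubling identity -/

section Doubling

variable [SecondCountableTopology G] {N : ℕ} (ρ : G →* Matrix (Fin N) (Fin N) ℂ) {L : ℕ} [NeZero L]

/-- A Wilson expectation is a tilted product-Haar moment divided by the partition function:
`∫ X dμ_b = (∫ X e^{−b S_W} dHaar) / ∫ e^{−b S_W} dHaar`. -/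
theorem integral_wilsonMeasure_eq_div (hρ : Continuous ρ) (X : GaugeConfig 4 L G → ℝ) (b : ℝ) :
    ∫ U, X U ∂(wilsonMeasure (d := 4) (L := L) ρ b) =
      (∫ U, X U * Real.exp (b * -wilsonAction ρ U) ∂(Measure.pi fun _ : Edge 4 L => haarProbability G)) /
        ∫ U, (1 : ℝ) * Real.exp (b * -wilsonAction ρ U)
          ∂(Measure.pi fun _ : Edge 4 L => haarProbability G) := by
  rw [wilsonMeasure_eq_tilted_pi ρ hρ, integral_tilted]
  simp only [one_mul, smul_eq_mul, neg_mul, mul_neg]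
  rw [← integral_div]
  refine integral_congr_ae (ae_of_all _ fun U => ?_)
  ring

/-- The partition function (as a tilted Haar moment of `1`) is positive. -/
theorem partition_pos (hρ : Continuous ρ) (b : ℝ) :
    0 < ∫ U, (1 : ℝ) * Real.exp (b * -wilsonAction ρ U)
      ∂(Measure.pi fun _ : Edge 4 L => haarProbability G) := by
  haveI : IsProbabilityMeasure (Measure.pi fun _ : Edge 4 L => haarProbability G) := by infer_instance
  simp only [one_mul]
  obtain ⟨B, hB⟩ := exists_abs_wilsonAction_le (d := 4) (L := L) ρ hρ
  refine integral_exp_pos (Integrable.of_bound (C := Real.exp (|b| * B)) ?_ (ae_of_all _ fun U => ?_))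
  · exact (((measurable_wilsonAction ρ hρ).neg.const_mul b).exp).aestronglyMeasurable
  · rw [Real.norm_eq_abs, Real.abs_exp, Real.exp_le_exp]
    calc b * -wilsonAction ρ U ≤ |b * -wilsonAction ρ U| := le_abs_self _
      _ = |b| * |wilsonAction ρ U| := by rw [abs_mul, abs_neg]
      _ ≤ |b| * B := by gcongr; exact hB U

/-- **The doubling identity.**  For bounded measurable `X, Y` on the torus link configurations,
`Z(b)² · (⟨XY⟩_b − ⟨X⟩_b⟨Y⟩_b) = ∫ X(U) (Y(U) − Y(U')) e^{−b(S_W(U) + S_W(U'))} d(U,U')` over the doubled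
product Haar measure. -/
theorem covariance_wilsonMeasure_eq_doubled (hρ : Continuous ρ) {X Y : GaugeConfig 4 L G → ℝ}
    (hXm : Measurable X) (hYm : Measurable Y) {CX CY : ℝ} (hX : ∀ U, |X U| ≤ CX) (hY : ∀ U, |Y U| ≤ CY)
    (b : ℝ) :
    (∫ U, (1 : ℝ) * Real.exp (b * -wilsonAction ρ U) ∂(Measure.pi fun _ : Edge 4 L => haarProbability G)) ^ 2 *
        ((∫ U, X U * Y U ∂(wilsonMeasure (d := 4) (L := L) ρ b)) -
          (∫ U, X U ∂(wilsonMeasure (d := 4) (L := L) ρ b)) *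
            ∫ U, Y U ∂(wilsonMeasure (d := 4) (L := L) ρ b)) =
      ∫ W, X (fun e => W (Sum.inl e)) * (Y (fun e => W (Sum.inl e)) - Y (fun e => W (Sum.inr e))) *
          Real.exp (b * -(wilsonAction ρ (fun e => W (Sum.inl e)) + wilsonAction ρ (fun e => W (Sum.inr e))))
        ∂(Measure.pi fun _ : Edge 4 L ⊕ Edge 4 L => haarProbability G) := by
  set μ₁ : Measure (GaugeConfig 4 L G) := Measure.pi fun _ : Edge 4 L => haarProbability G with hμ₁
  set μ₂ : Measure (Edge 4 L ⊕ Edge 4 L → G) := Measure.pi fun _ : Edge 4 L ⊕ Edge 4 L => haarProbability G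
    with hμ₂
  haveI : IsProbabilityMeasure μ₁ := by rw [hμ₁]; infer_instance
  haveI : IsProbabilityMeasure μ₂ := by rw [hμ₂]; infer_instance
  obtain ⟨B, hB⟩ := exists_abs_wilsonAction_le (d := 4) (L := L) ρ hρ
  have hSm : Measurable (wilsonAction (d := 4) (L := L) (G := G) ρ) := measurable_wilsonAction ρ hρ
  set w : GaugeConfig 4 L G → ℝ := fun U => Real.exp (b * -wilsonAction ρ U) with hw
  have hwm : Measurable w := ((hSm.neg).const_mul b).exp
  have hwb : ∀ U, |w U| ≤ Real.exp (|b| * B) := fun U => by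
    rw [hw, Real.abs_exp, Real.exp_le_exp]
    calc b * -wilsonAction ρ U ≤ |b * -wilsonAction ρ U| := le_abs_self _
      _ = |b| * |wilsonAction ρ U| := by rw [abs_mul, abs_neg]
      _ ≤ |b| * B := by gcongr; exact hB U
  have hZ := partition_pos (L := L) ρ hρ b
  set Z : ℝ := ∫ U, (1 : ℝ) * Real.exp (b * -wilsonAction ρ U) ∂μ₁ with hZdef
  rw [integral_wilsonMeasure_eq_div ρ hρ, integral_wilsonMeasure_eq_div ρ hρ,
    integral_wilsonMeasure_eq_div ρ hρ]
  have hZne : Z ≠ 0 := hZ.ne'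
  -- the three numerators and `Z` as integrals against `π`
  set N₁ : ℝ := ∫ U, X U * Y U * w U ∂μ₁ with hN₁
  set N₂ : ℝ := ∫ U, X U * w U ∂μ₁ with hN₂
  set N₃ : ℝ := ∫ U, Y U * w U ∂μ₁ with hN₃
  have hZ1 : Z = ∫ U, w U ∂μ₁ := by rw [hZdef]; simp only [one_mul, hw]
  -- `Z N₁` and `N₂ N₃` as integrals over the doubled configuration
  have hprod : ∀ f g : GaugeConfig 4 L G → ℝ,
      (∫ U, f U ∂μ₁) * (∫ U, g U ∂μ₁) =
        ∫ W, f (fun e => W (Sum.inl e)) * g (fun e => W (Sum.inr e)) ∂μ₂ := fun f g => by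
    rw [← integral_prod_mul (μ := μ₁) (ν := μ₁) f g]
    have h := (measurePreserving_sumPiEquivProdPi fun _ : Edge 4 L ⊕ Edge 4 L => haarProbability G)
    rw [← h.integral_comp' (g := fun z : GaugeConfig 4 L G × GaugeConfig 4 L G => f z.1 * g z.2)]
    rfl
  have h1 : Z * N₁ = ∫ W, w (fun e => W (Sum.inr e)) *
      (X (fun e => W (Sum.inl e)) * Y (fun e => W (Sum.inl e)) * w (fun e => W (Sum.inl e))) ∂μ₂ := by
    rw [hZ1, hN₁, mul_comm, hprod]
    refine integral_congr_ae (ae_of_all _ fun W => ?_)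
    simp only
    ring
  have h2 : N₂ * N₃ = ∫ W, X (fun e => W (Sum.inl e)) * w (fun e => W (Sum.inl e)) *
      (Y (fun e => W (Sum.inr e)) * w (fun e => W (Sum.inr e))) ∂μ₂ := by
    rw [hN₂, hN₃, hprod]
  -- integrability of the two doubled integrands
  have hCX : 0 ≤ CX := le_trans (abs_nonneg _) (hX fun _ => 1)
  have hCY : 0 ≤ CY := le_trans (abs_nonneg _) (hY fun _ => 1)
  have hi1 : Integrable (fun W : Edge 4 L ⊕ Edge 4 L → G => w (fun e => W (Sum.inr e)) *
      (X (fun e => W (Sum.inl e)) * Y (fun e => W (Sum.inl e)) * w (fun e => W (Sum.inl e)))) μ₂ := by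
    refine Integrable.of_bound (C := Real.exp (|b| * B) * (CX * CY * Real.exp (|b| * B)))
      ((hwm.comp measurable_inr_copy).mul (((hXm.comp measurable_inl_copy).mul
        (hYm.comp measurable_inl_copy)).mul (hwm.comp measurable_inl_copy))).aestronglyMeasurable
      (ae_of_all _ fun W => ?_)
    rw [Real.norm_eq_abs, abs_mul, abs_mul, abs_mul]
    refine mul_le_mul (hwb _) (mul_le_mul (mul_le_mul (hX _) (hY _) (abs_nonneg _) hCX) (hwb _)
      (abs_nonneg _) (mul_nonneg hCX hCY)) (by positivity) (by positivity)
  have hi2 : Integrable (fun W : Edge 4 L ⊕ Edge 4 L → G => X (fun e => W (Sum.inl e)) *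
      w (fun e => W (Sum.inl e)) * (Y (fun e => W (Sum.inr e)) * w (fun e => W (Sum.inr e)))) μ₂ := by
    refine Integrable.of_bound (C := CX * Real.exp (|b| * B) * (CY * Real.exp (|b| * B)))
      ((((hXm.comp measurable_inl_copy).mul (hwm.comp measurable_inl_copy))).mul
        ((hYm.comp measurable_inr_copy).mul (hwm.comp measurable_inr_copy))).aestronglyMeasurable
      (ae_of_all _ fun W => ?_)
    rw [Real.norm_eq_abs, abs_mul, abs_mul, abs_mul]
    exact mul_le_mul (mul_le_mul (hX _) (hwb _) (abs_nonneg _) hCX)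
      (mul_le_mul (hY _) (hwb _) (abs_nonneg _) hCY) (by positivity) (by positivity)
  -- assemble
  have key : Z ^ 2 * (N₁ / Z - N₂ / Z * (N₃ / Z)) = Z * N₁ - N₂ * N₃ := by
    field_simp
  rw [key, h1, h2, ← integral_sub hi1 hi2]
  refine integral_congr_ae (ae_of_all _ fun W => ?_)
  simp only [hw]
  rw [show b * -(wilsonAction ρ (fun e => W (Sum.inl e)) + wilsonAction ρ (fun e => W (Sum.inr e))) =
      b * -wilsonAction ρ (fun e => W (Sum.inl e)) + b * -wilsonAction ρ (fun e => W (Sum.inr e)) by ring,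
    Real.exp_add]
  ring

end Doubling

/-! ## §2 The order of vanishing of the slice correlator at `b = 0` -/

section Order

variable (r : LatticeRep G) (A : YMSpecies G)

omit [TopologicalSpace G] [IsTopologicalGroup G] [CompactSpace G] [BorelSpace G] in
/-- The torus version of a time-zero slice species depends only on time-zero spatial links. -/
theorem dependsOn_toTorus_slice (L : ℕ) (hA : ∀ e ∈ A.supp, e.1 0 = 0 ∧ e.2 ≠ 0) :
    DependsOn (fun U : GaugeConfig 4 L G => A.F (torusLift L U))
      {e : Edge 4 L | e.1 0 = 0 ∧ e.2 ≠ 0} := by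
  intro U V hUV
  apply A.isCylinder
  intro e he
  obtain ⟨he0, he2⟩ := hA e (Finset.mem_coe.mp he)
  simp only [torusLift, Function.comp_apply]
  apply hUV
  refine ⟨?_, he2⟩
  simp [torusEdge, Literature.Probability.LatticeModels.Torus.proj, he0]

omit [TopologicalSpace G] [IsTopologicalGroup G] [CompactSpace G] [BorelSpace G] in
/-- The time-`n` translate of a time-zero slice species depends only on time-`n` spatial links. -/
theorem dependsOn_toTorus_slice_shift (L n : ℕ) (hA : ∀ e ∈ A.supp, e.1 0 = 0 ∧ e.2 ≠ 0) :
    DependsOn (fun U : GaugeConfig 4 L G =>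
        A.F (configShift (-Pi.single 0 (n : ℤ)) (torusLift L U)))
      {e : Edge 4 L | e.1 0 = (n : ZMod L) ∧ e.2 ≠ 0} := by
  intro U V hUV
  apply A.isCylinder
  intro e he
  obtain ⟨he0, he2⟩ := hA e (Finset.mem_coe.mp he)
  simp only [configShift_apply, torusLift, Function.comp_apply]
  apply hUV
  refine ⟨?_, he2⟩
  simp [torusEdge, Literature.Probability.LatticeModels.Torus.proj, he0]

/-- **Real-analyticity and the doubled representation of the slice correlator.**  For bounded measurable
observables the connected torus correlator is `b ↦ Ψ(b) / Z(b)²` with `Ψ, Z` tilted Haar moments; in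
particular it is real-analytic at every `b`. -/
theorem analyticAt_latticeConnectedCorr (S n : ℕ) (b₀ : ℝ) :
    AnalyticAt ℝ (fun b => latticeConnectedCorr r.ρ b (2 * S + 1) A.F A.F n) b₀ := by
  haveI : SecondCountableTopology G :=
    (r.continuous.isClosedEmbedding r.injective).isEmbedding.secondCountableTopology
  haveI : IsProbabilityMeasure (Measure.pi fun _ : Edge 4 (2 * S + 1) => haarProbability G) := by
    infer_instance
  obtain ⟨CA, hCA⟩ := A.bounded
  obtain ⟨B, hB⟩ := exists_abs_wilsonAction_le (d := 4) (L := 2 * S + 1) r.ρ r.continuous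
  have hSm := measurable_wilsonAction (d := 4) (L := 2 * S + 1) (G := G) r.ρ r.continuous
  set F : GaugeConfig 4 (2 * S + 1) G → ℝ := fun U => A.F (torusLift (2 * S + 1) U) with hF
  set Gd : GaugeConfig 4 (2 * S + 1) G → ℝ := fun U =>
    A.F (configShift (-Pi.single 0 (n : ℤ)) (torusLift (2 * S + 1) U)) with hGd
  have hFm : Measurable F := A.measurable.comp (measurable_torusLift _)
  have hGm : Measurable Gd := A.measurable.comp ((configShift _).measurable.comp (measurable_torusLift _))
  have hT : ∀ U : GaugeConfig 4 (2 * S + 1) G, |(-wilsonAction r.ρ U)| ≤ B := fun U => by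
    rw [abs_neg]; exact hB U
  -- each Wilson expectation is a quotient of entire functions
  have hN : ∀ {X : GaugeConfig 4 (2 * S + 1) G → ℝ} (hXm : Measurable X) {C : ℝ} (hX : ∀ U, |X U| ≤ C),
      AnalyticAt ℝ (fun b => ∫ U, X U ∂(wilsonMeasure (d := 4) (L := 2 * S + 1) r.ρ b)) b₀ := by
    intro X hXm C hX
    have heq : (fun b => ∫ U, X U ∂(wilsonMeasure (d := 4) (L := 2 * S + 1) r.ρ b)) = fun b =>
        (∫ U, X U * Real.exp (b * -wilsonAction r.ρ U)
            ∂(Measure.pi fun _ : Edge 4 (2 * S + 1) => haarProbability G)) /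
          ∫ U, (1 : ℝ) * Real.exp (b * -wilsonAction r.ρ U)
            ∂(Measure.pi fun _ : Edge 4 (2 * S + 1) => haarProbability G) :=
      funext fun b => integral_wilsonMeasure_eq_div r.ρ r.continuous X b
    rw [heq]
    refine (analyticAt_integral_mul_exp _ hXm hX hSm.neg hT b₀).div
      (analyticAt_integral_mul_exp _ measurable_const (C := 1) (fun _ => by simp) hSm.neg hT b₀)
      (partition_pos r.ρ r.continuous b₀).ne'
  have hCA' : ∀ U : GaugeConfig 4 (2 * S + 1) G, |F U| ≤ CA := fun U => hCA _
  have hCG' : ∀ U : GaugeConfig 4 (2 * S + 1) G, |Gd U| ≤ CA := fun U => hCA _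
  have hFG : ∀ U : GaugeConfig 4 (2 * S + 1) G, |F U * Gd U| ≤ CA * CA := fun U => by
    rw [abs_mul]; exact mul_le_mul (hCA' U) (hCG' U) (abs_nonneg _) (le_trans (abs_nonneg _) (hCA' U))
  have key : (fun b => latticeConnectedCorr r.ρ b (2 * S + 1) A.F A.F n) = fun b =>
      (∫ U, F U * Gd U ∂(wilsonMeasure (d := 4) (L := 2 * S + 1) r.ρ b)) -
        (∫ U, F U ∂(wilsonMeasure (d := 4) (L := 2 * S + 1) r.ρ b)) *
          ∫ U, F U ∂(wilsonMeasure (d := 4) (L := 2 * S + 1) r.ρ b) := by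
    funext b; simp only [latticeConnectedCorr, hF, hGd]
  rw [key]
  exact (hN (hFm.mul hGm) hFG).sub ((hN hFm hCA').mul (hN hFm hCA'))

/-- **ORDER OF VANISHING.**  For a time-zero slice species `A` (supported on spatial links of the time-zero
hyperplane) and `1 ≤ n ≤ S`, the connected correlator `b ↦ D_b(S, A, n)` on the odd torus `(2S+1)⁴` vanishes
at `b = 0` to order at least `n`: the Haar measure (`b = 0`) needs at least one plaquette per time step
between the two slices before the connected correlation of the two copies can tell them apart. -/
theorem le_analyticOrderAt_latticeConnectedCorr (hA : ∀ e ∈ A.supp, e.1 0 = 0 ∧ e.2 ≠ 0) {S n : ℕ}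
    (hn : n ≤ S) :
    (n : ℕ∞) ≤ analyticOrderAt (fun b => latticeConnectedCorr r.ρ b (2 * S + 1) A.F A.F n) 0 := by
  haveI : SecondCountableTopology G :=
    (r.continuous.isClosedEmbedding r.injective).isEmbedding.secondCountableTopology
  haveI : IsProbabilityMeasure
      (Measure.pi fun _ : Edge 4 (2 * S + 1) ⊕ Edge 4 (2 * S + 1) => haarProbability G) := by
    infer_instance
  obtain ⟨CA, hCA⟩ := A.bounded
  obtain ⟨B, hB⟩ := exists_abs_wilsonAction_le (d := 4) (L := 2 * S + 1) r.ρ r.continuous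
  have hSm := measurable_wilsonAction (d := 4) (L := 2 * S + 1) (G := G) r.ρ r.continuous
  set F : GaugeConfig 4 (2 * S + 1) G → ℝ := fun U => A.F (torusLift (2 * S + 1) U) with hF
  set Gd : GaugeConfig 4 (2 * S + 1) G → ℝ := fun U =>
    A.F (configShift (-Pi.single 0 (n : ℤ)) (torusLift (2 * S + 1) U)) with hGd
  have hFm : Measurable F := A.measurable.comp (measurable_torusLift _)
  have hGm : Measurable Gd := A.measurable.comp ((configShift _).measurable.comp (measurable_torusLift _))
  have hCA' : ∀ U : GaugeConfig 4 (2 * S + 1) G, |F U| ≤ CA := fun U => hCA _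
  have hCG' : ∀ U : GaugeConfig 4 (2 * S + 1) G, |Gd U| ≤ CA := fun U => hCA _
  -- the doubled objects
  set Φ : (Edge 4 (2 * S + 1) ⊕ Edge 4 (2 * S + 1) → G) → ℝ := fun W =>
    F (fun e => W (Sum.inl e)) * (Gd (fun e => W (Sum.inl e)) - Gd (fun e => W (Sum.inr e))) with hΦ
  set T : (Edge 4 (2 * S + 1) ⊕ Edge 4 (2 * S + 1) → G) → ℝ := fun W =>
    -(wilsonAction r.ρ (fun e => W (Sum.inl e)) + wilsonAction r.ρ (fun e => W (Sum.inr e))) with hT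
  set Z : ℝ → ℝ := fun b => ∫ U, (1 : ℝ) * Real.exp (b * -wilsonAction r.ρ U)
    ∂(Measure.pi fun _ : Edge 4 (2 * S + 1) => haarProbability G) with hZ
  set Ψ : ℝ → ℝ := fun b => ∫ W, Φ W * Real.exp (b * T W)
    ∂(Measure.pi fun _ : Edge 4 (2 * S + 1) ⊕ Edge 4 (2 * S + 1) => haarProbability G) with hΨ
  have hΦm : Measurable Φ :=
    (hFm.comp measurable_inl_copy).mul ((hGm.comp measurable_inl_copy).sub (hGm.comp measurable_inr_copy))
  have hCA0 : 0 ≤ CA := le_trans (abs_nonneg _) (hCA' fun _ => 1)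
  have hΦb : ∀ W, |Φ W| ≤ CA * (2 * CA) := fun W => by
    have hg1 := hCG' (fun e => W (Sum.inl e))
    have hg2 := hCG' (fun e => W (Sum.inr e))
    rw [hΦ, abs_mul]
    exact mul_le_mul (hCA' _) (le_trans (abs_sub _ _) (by linarith)) (abs_nonneg _) hCA0
  have hTm : Measurable T := ((hSm.comp measurable_inl_copy).add (hSm.comp measurable_inr_copy)).neg
  have hTb : ∀ W, |T W| ≤ 2 * B := fun W => by
    have h1 := hB (fun e => W (Sum.inl e))
    have h2 := hB (fun e => W (Sum.inr e))
    rw [hT, abs_neg]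
    exact le_trans (abs_add_le _ _) (by linarith)
  -- (i) the doubling identity `Z² D = Ψ` and `D = Ψ / Z²`
  have hZpos : ∀ b, 0 < Z b := fun b => partition_pos r.ρ r.continuous b
  -- translation invariance: `⟨τₙA⟩_b = ⟨A⟩_b`
  have hGdF : Gd = fun U => toTorusObservable (2 * S + 1) A.F
      (torusConfigShift (Literature.Probability.LatticeModels.Torus.proj (2 * S + 1)
        (-Pi.single (0 : Fin 4) (n : ℤ))) U) := by
    have hc := toTorusObservable_comp_configShift (G := G) (2 * S + 1) (-Pi.single (0 : Fin 4) (n : ℤ)) A.F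
    funext U
    exact congrFun hc U
  have hGF : ∀ b : ℝ, ∫ U, Gd U ∂(wilsonMeasure (d := 4) (L := 2 * S + 1) r.ρ b) =
      ∫ U, F U ∂(wilsonMeasure (d := 4) (L := 2 * S + 1) r.ρ b) := fun b => by
    have h := wilsonExpectation_comp_torusConfigShift r.ρ b
      (Literature.Probability.LatticeModels.Torus.proj (2 * S + 1) (-Pi.single (0 : Fin 4) (n : ℤ)))
      (toTorusObservable (2 * S + 1) A.F)
    rw [hGdF, hF]
    simpa only [wilsonExpectation, Function.comp_apply, toTorusObservable_apply] using h
  have hD : (fun b => latticeConnectedCorr r.ρ b (2 * S + 1) A.F A.F n) = fun b => Ψ b * (Z b ^ 2)⁻¹ := by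
    funext b
    have h := covariance_wilsonMeasure_eq_doubled (L := 2 * S + 1) r.ρ r.continuous hFm hGm hCA' hCG' b
    have hZb : Z b ^ 2 ≠ 0 := pow_ne_zero 2 (hZpos b).ne'
    have hlc : latticeConnectedCorr r.ρ b (2 * S + 1) A.F A.F n =
        (∫ U, F U * Gd U ∂(wilsonMeasure (d := 4) (L := 2 * S + 1) r.ρ b)) -
          (∫ U, F U ∂(wilsonMeasure (d := 4) (L := 2 * S + 1) r.ρ b)) *
            ∫ U, Gd U ∂(wilsonMeasure (d := 4) (L := 2 * S + 1) r.ρ b) := by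
      rw [hGF b]
      simp only [latticeConnectedCorr, hF, hGd]
    rw [hlc, eq_mul_inv_iff_mul_eq₀ hZb, mul_comm, h]
  -- (ii) analyticity of `Ψ` and `Z`, order of `Ψ` at `0`
  have hΨan : AnalyticAt ℝ Ψ 0 := analyticAt_integral_mul_exp _ hΦm hΦb hTm hTb 0
  have hZan : AnalyticAt ℝ (fun b => (Z b ^ 2)⁻¹) 0 := by
    have hT1 : ∀ U : GaugeConfig 4 (2 * S + 1) G, |(-wilsonAction r.ρ U)| ≤ B := fun U => by
      rw [abs_neg]; exact hB U
    exact ((analyticAt_integral_mul_exp _ measurable_const (C := 1) (fun _ => by simp) hSm.neg hT1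
      0).pow 2).inv (pow_ne_zero 2 (hZpos 0).ne')
  have hmom : ∀ j < n, ∫ W, Φ W * T W ^ j
      ∂(Measure.pi fun _ : Edge 4 (2 * S + 1) ⊕ Edge 4 (2 * S + 1) => haarProbability G) = 0 := by
    intro j hj
    have h0 := integral_doubledMoment_eq_zero (L := 2 * S + 1) r.ρ r.continuous hFm hGm hCA' hCG'
      (dependsOn_toTorus_slice A (2 * S + 1) hA) (dependsOn_toTorus_slice_shift A (2 * S + 1) n hA)
      (by omega) hj
    have hpow : ∀ W, Φ W * T W ^ j = (-1) ^ j * (Φ W *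
        (wilsonAction r.ρ (fun e => W (Sum.inl e)) + wilsonAction r.ρ (fun e => W (Sum.inr e))) ^ j) := by
      intro W
      have hTW : T W = -(wilsonAction r.ρ (fun e => W (Sum.inl e)) +
          wilsonAction r.ρ (fun e => W (Sum.inr e))) := rfl
      rw [hTW, neg_pow]
      ring
    rw [integral_congr_ae (ae_of_all _ hpow), integral_const_mul, h0, mul_zero]
  have hΨord : (n : ℕ∞) ≤ analyticOrderAt Ψ 0 := le_analyticOrderAt_integral_mul_exp _ hΦm hΦb hTm hTb hmom
  -- (iii) order of `D = Ψ · (Z²)⁻¹`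
  have hmul : (fun b => Ψ b * (Z b ^ 2)⁻¹) = Ψ * fun b => (Z b ^ 2)⁻¹ := rfl
  rw [hD, hmul, analyticOrderAt_mul hΨan hZan,
    (hZan.analyticOrderAt_eq_zero).2 (inv_ne_zero (pow_ne_zero 2 (hZpos 0).ne')), add_zero]
  exact hΨord

end Order

/-! ## §3 The strong-coupling rung, pointwise in `(S, n, A)` -/

/-- **STRONG-COUPLING RUNG (pointwise form, PROVED).**  For every compact `G`, every lattice representation
`r`, every time-zero slice species `A` (`∀ e ∈ A.supp, e.1 0 = 0 ∧ e.2 ≠ 0`, the class `IsSliceObs` of the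
skeleton), every torus `(2S+1)⁴` with `1 ≤ S` and every separation `n ≤ S` there are `K` and `β_sc > 0` such
that the β-slope floor with slope `n / b` holds at strong coupling:
`(n / b − K) · D_b(S, A, n) ≤ ∂_b D_b(S, A, n)` for all `0 < b ≤ β_sc`, where
`D_b(S, A, n) = latticeConnectedCorr r.ρ b (2S+1) A A n` (the skeleton's `diagCorr r b S A n`, δ-unfolded).
Ingredients: order of vanishing `≥ n` at `b = 0` (§2), reflection positivity `D_b ≥ 0` for `b ≥ 0`
(`SoloBlind.latticeConnectedCorr_self_nonneg`), and the calculus lemma `exists_slope_floor_of_le_analyticOrderAt`.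
This is the registered `stub_rung_strongCoupling` with slope constant `1` instead of `2` and with `β_sc, K`
depending on `(S, n, A)` instead of `β_sc = β_sc(G, r)`, `K = K_A`; the volume-uniform form is not proved here. -/
theorem rung_strongCoupling_pointwise (r : LatticeRep G) (A : YMSpecies G)
    (hA : ∀ e ∈ A.supp, e.1 0 = 0 ∧ e.2 ≠ 0) {S n : ℕ} (hS : 1 ≤ S) (hn : n ≤ S) :
    ∃ K βsc : ℝ, 0 < βsc ∧ ∀ b : ℝ, 0 < b → b ≤ βsc →
      (n / b - K) * latticeConnectedCorr r.ρ b (2 * S + 1) A.F A.F n ≤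
        deriv (fun b' => latticeConnectedCorr r.ρ b' (2 * S + 1) A.F A.F n) b :=
  exists_slope_floor_of_le_analyticOrderAt (analyticAt_latticeConnectedCorr r A S n 0) one_pos
    (fun _ hb _ => Summit.QuantumFields.YangMills.Theorems.SoloBlind.latticeConnectedCorr_self_nonneg
      r.ρ r.continuous hb.le hS A hA n)
    (le_analyticOrderAt_latticeConnectedCorr r A hA hn)

end Summit.QuantumFields.YangMills.Cruxes.IR.BetaSlopeFloor

end
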